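import Summits.KontsevichZagierPeriods.Zeta5Search.Certificates.PolyReflectCoord
import Summits.KontsevichZagierPeriods.Zeta5Search.Certificates.PolyReflectGrid
import HarnessLib

/-!
# ζ(5) search — coordinate-form module reduction checked on a GRID in `k` (cell `pub-zeta5`, certifier `cert-2`)

HONEST FRAMING: systematic search; recurrence certificates; no irrationality claim unless certified.

The grid form of `PolyReflectCoord.coord_sum_eq_zero` for certificates whose three-variable packed integers are too big
(L-NK): the `k`-extent (number of blocks) of every entry of `G = coordG …` is bounded by a computable shadow
(`coordKlen`, proved by `klen_coordG`), and `G = 0` follows from `K` two-variable packed checks — one per integer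
`k₀ = 0, …, K−1` — via `PolyReflectGrid.ev3_kspec_eq_zero_of_packed` and `ev3_eq_zero_of_kgrid`.
Main theorems: `coord_sum_mul_eq_zero_grid`, `coord_sum_eq_zero_grid`.
-/

namespace Summit.KontsevichZagierPeriods.Zeta5Search.PolyReflect

/-! ### `k`-extent (number of blocks) through the polynomial operations -/

/-- Length of a sum. -/
theorem length_add3 : ∀ p q : Poly3, (add3 p q).length = max p.length q.length
  | [], q => by simp [add3]
  | a :: p, [] => by simp [add3]
  | a :: p, b :: q => by simp [add3, length_add3 p q, Nat.succ_max_succ]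

/-- Length of a block-scalar multiple. -/
theorem length_smul3 (c : Poly2) : ∀ p : Poly3, (smul3 c p).length = p.length
  | [] => by simp [smul3]
  | a :: p => by simp [smul3, length_smul3 c p]

/-- Length of a product. -/
theorem length_mul3 : ∀ p q : Poly3, (mul3 p q).length ≤ max p.length (p.length + q.length - 1)
  | [], q => by simp [mul3]
  | a :: p, q => by
    simp only [mul3, length_add3, length_smul3, List.length_cons]
    have := length_mul3 p q; omega

/-- Length of a product, with bounds `≥ 1`. -/
theorem length_mul3_le {Kp Kq : ℕ} (hKp : 1 ≤ Kp) (hKq : 1 ≤ Kq) (p q : Poly3) (hp : p.length ≤ Kp)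
    (hq : q.length ≤ Kq) : (mul3 p q).length ≤ Kp + Kq - 1 := by
  have := length_mul3 p q; omega

/-- Length of a negation. -/
theorem length_neg3 (p : Poly3) : (neg3 p).length = p.length := length_smul3 _ p

/-! ### `k`-extent through combinations and runs -/

/-- Maximal entry length of a combination (at least `1`). -/
def klenMeasure : LC → ℕ
  | [] => 1
  | c :: E => max c.length (klenMeasure E)

/-- `1 ≤ klenMeasure E`. -/
theorem one_le_klenMeasure : ∀ E : LC, 1 ≤ klenMeasure E
  | [] => le_rfl
  | _ :: E => (one_le_klenMeasure E).trans (le_max_right _ _)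

/-- Entries are bounded by the measure. -/
theorem klen_measure : ∀ (E : LC), ∀ c ∈ E, c.length ≤ klenMeasure E
  | [], _, hc => by simp at hc
  | d :: E, c, hc => by
    simp only [klenMeasure]
    rcases List.mem_cons.1 hc with rfl | hc
    · exact le_max_left _ _
    · exact (klen_measure E c hc).trans (le_max_right _ _)

/-- Entry lengths of `lcGet`. -/
theorem klen_lcGet {K : ℕ} : ∀ (E : LC) (s : ℕ), (∀ c ∈ E, c.length ≤ K) → (lcGet E s).length ≤ K
  | [], _, _ => by simp [lcGet]
  | c :: E, 0, h => h c (by simp)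
  | c :: E, s + 1, h => klen_lcGet E s fun d hd => h d (by simp [hd])

/-- Entry lengths of `lcSmul`. -/
theorem klen_lcSmul {Ka K : ℕ} (hKa : 1 ≤ Ka) (hK : 1 ≤ K) (a : Poly3) (ha : a.length ≤ Ka) :
    ∀ E : LC, (∀ c ∈ E, c.length ≤ K) → ∀ c ∈ lcSmul a E, c.length ≤ Ka + K - 1
  | [], _ => by simp [lcSmul]
  | c :: E, h => by
    intro d hd
    simp only [lcSmul, List.mem_cons] at hd
    rcases hd with rfl | hd
    · exact length_mul3_le hKa hK a c ha (h c (by simp))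
    · exact klen_lcSmul hKa hK a ha E (fun e he => h e (by simp [he])) d hd

/-- Entry lengths of `lcAdd`. -/
theorem klen_lcAdd {K K' : ℕ} : ∀ E F : LC, (∀ c ∈ E, c.length ≤ K) → (∀ c ∈ F, c.length ≤ K') →
    ∀ c ∈ lcAdd E F, c.length ≤ max K K'
  | [], F, _, hF => fun c hc => by
    have := hF c (by simpa [lcAdd] using hc); exact this.trans (le_max_right _ _)
  | a :: E, [], hE, _ => fun c hc => by
    have := hE c (by simpa [lcAdd] using hc); exact this.trans (le_max_left _ _)
  | a :: E, b :: F, hE, hF => by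
    intro c hc
    simp only [lcAdd, List.mem_cons] at hc
    rcases hc with rfl | hc
    · rw [length_add3]; exact max_le_max (hE a (by simp)) (hF b (by simp))
    · exact klen_lcAdd E F (fun e he => hE e (by simp [he])) (fun e he => hF e (by simp [he])) c hc

/-- One two-kill step: `E` entries `≤ K`, `a :: R₁ ++ R₂` entries `≤ KR` ⇒ result entries `≤ KR + K − 1`. -/
theorem klen_elimStep2 {K KR : ℕ} (hK : 1 ≤ K) (hKR : 1 ≤ KR) (a : Poly3) (R₁ : LC) (s₁ : ℕ) (R₂ : LC) (s₂ : ℕ)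
    (E : LC) (hE : ∀ c ∈ E, c.length ≤ K) (hR : ∀ c ∈ a :: (R₁ ++ R₂), c.length ≤ KR) :
    ∀ c ∈ elimStep2 a R₁ s₁ R₂ s₂ E, c.length ≤ KR + K - 1 := by
  have ha := hR a (by simp)
  have hR₁ : ∀ c ∈ R₁, c.length ≤ KR := fun c hc => hR c (by simp [hc])
  have hR₂ : ∀ c ∈ R₂, c.length ≤ KR := fun c hc => hR c (by simp [hc])
  have h1 := klen_lcSmul hKR hK a ha E hE
  have h2 := klen_lcSmul hK hKR (neg3 (lcGet E s₁)) (by rw [length_neg3]; exact klen_lcGet E s₁ hE) R₁ hR₁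
  have h3 := klen_lcSmul hK hKR (neg3 (lcGet E s₂)) (by rw [length_neg3]; exact klen_lcGet E s₂ hE) R₂ hR₂
  rw [show K + KR - 1 = KR + K - 1 by omega] at h2 h3
  have h12 := klen_lcAdd _ _ h1 h2
  have h := klen_lcAdd _ _ h12 h3
  rw [elimStep2]
  intro c hc
  have := h c hc
  simp only [max_self] at this
  exact this

/-- The `k`-extent shadow of a two-kill run. -/
def klenShadow2 (rels : List LC) : List (ℕ × ℕ × ℕ × ℕ × Poly3) → ℕ → ℕ
  | [], K => K
  | (r₁, _, r₂, _, a) :: st, K => klenShadow2 rels st (klenMeasure (a :: (rels.getD r₁ [] ++ rels.getD r₂ [])) + K - 1)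

/-- Soundness of the `k`-extent shadow of a run. -/
theorem klen_elimRun2 (rels : List LC) : ∀ (st : List (ℕ × ℕ × ℕ × ℕ × Poly3)) (E : LC) (K : ℕ), 1 ≤ K →
    (∀ c ∈ E, c.length ≤ K) → ∀ c ∈ elimRun2 rels st E, c.length ≤ klenShadow2 rels st K
  | [], E, K, _, h => by simpa [klenShadow2, elimRun2] using h
  | (r₁, s₁, r₂, s₂, a) :: st, E, K, hK, h => by
    have hm := one_le_klenMeasure (a :: (rels.getD r₁ [] ++ rels.getD r₂ []))
    have hR := klen_measure (a :: (rels.getD r₁ [] ++ rels.getD r₂ []))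
    simp only [klenShadow2, elimRun2]
    exact klen_elimRun2 rels st _ _ (by omega) (klen_elimStep2 hK hm a _ s₁ _ s₂ E h hR)

/-- `1 ≤ klenShadow2 …` when `1 ≤ K`. -/
theorem one_le_klenShadow2 (rels : List LC) : ∀ (st : List (ℕ × ℕ × ℕ × ℕ × Poly3)) (K : ℕ), 1 ≤ K →
    1 ≤ klenShadow2 rels st K
  | [], K, hK => by simpa [klenShadow2] using hK
  | (r₁, s₁, r₂, s₂, a) :: st, K, hK => by
    simp only [klenShadow2]
    have hm := one_le_klenMeasure (a :: (rels.getD r₁ [] ++ rels.getD r₂ []))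
    exact one_le_klenShadow2 rels st _ (by omega)

/-! ### `k`-extent of coefficient trees and of `G` -/

/-- `linPoly f` has two blocks. -/
theorem length_linPoly (f : ℤ × ℤ × ℤ × ℤ) : (linPoly f).length = 2 := by
  obtain ⟨a, b, c, d⟩ := f; rfl

/-- `mkProd FT idx` has at most `|idx| + 1` blocks. -/
theorem length_mkProd (FT : List (ℤ × ℤ × ℤ × ℤ)) : ∀ idx : List ℕ, (mkProd FT idx).length ≤ idx.length + 1
  | [] => by simp [mkProd, cst3]
  | i :: idx => by
    rw [mkProd, List.length_cons]
    have := length_mul3_le (Kp := 2) (Kq := idx.length + 1) (by omega) (by omega)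
      (linPoly (FT.getD i (0, 0, 0, 0))) (mkProd FT idx) (by rw [length_linPoly]) (length_mkProd FT idx)
    omega

/-- `mkMult FT σ idx` has at most `|idx| + 1` blocks. -/
theorem length_mkMult (FT : List (ℤ × ℤ × ℤ × ℤ)) (σ : ℤ) (idx : List ℕ) :
    (mkMult FT σ idx).length ≤ idx.length + 1 := by
  rw [mkMult]
  have := length_mul3_le (Kp := 1) (Kq := idx.length + 1) le_rfl (by omega) (cst3 σ) _ (by simp [cst3])
    (length_mkProd FT idx)
  omega

/-- The coefficient tree `ccoef` has at most `max |C| 1 + |cof ++ cidx|` blocks. -/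
theorem length_ccoef (FT : List (ℤ × ℤ × ℤ × ℤ)) (t : CTerm) :
    (ccoef FT t).length ≤ max t.1.length 1 + (t.2.2.2.1 ++ t.2.1).length := by
  rw [ccoef]
  have := length_mul3_le (Kp := (t.2.2.2.1 ++ t.2.1).length + 1) (Kq := max t.1.length 1) (by omega)
    (le_max_right _ _) (mkMult FT (fsign t.2.2.2.2) (t.2.2.2.1 ++ t.2.1)) t.1
    (length_mkMult FT (fsign t.2.2.2.2) (t.2.2.2.1 ++ t.2.1)) (le_max_left _ _)
  omega

/-- The `k`-extent shadow of `G = coordG FT rels ts`. -/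
def coordKlen (FT : List (ℤ × ℤ × ℤ × ℤ)) (rels : List LC) : List CTerm → ℕ
  | [] => 1
  | (C, cidx, X, cof, st) :: ts =>
    max (max C.length 1 + (cof ++ cidx).length + klenShadow2 rels (fpath FT st) (klenMeasure (lcSingle X (cst3 1))) - 1)
      (coordKlen FT rels ts)

/-- **Soundness of the `k`-extent shadow of `G`.** -/
theorem klen_coordG (FT : List (ℤ × ℤ × ℤ × ℤ)) (rels : List LC) :
    ∀ ts : List CTerm, ∀ c ∈ coordG FT rels ts, c.length ≤ coordKlen FT rels ts
  | [] => by simp [coordG]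
  | (C, cidx, X, cof, st) :: ts => by
    have hrest := klen_coordG FT rels ts
    have hcf := length_ccoef FT (C, cidx, X, cof, st)
    have hmE := one_le_klenMeasure (lcSingle X (cst3 1))
    have hE := klen_measure (lcSingle X (cst3 1))
    have hrun := klen_elimRun2 rels (fpath FT st) (lcSingle X (cst3 1)) _ hmE hE
    have hS1 := one_le_klenShadow2 rels (fpath FT st) _ hmE
    have hsm := klen_lcSmul (Ka := max C.length 1 + (cof ++ cidx).length) (by omega) hS1 _ hcf _ hrun
    intro d hd
    simp only [coordG] at hd
    simp only [coordKlen]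
    have hadd := klen_lcAdd _ _ hsm hrest
    exact hadd d hd

/-! ### The grid form of the coordinate check -/

/-- Boolean side conditions of the grid check: row bound `D₁`, grid size `K` (≥ the `k`-extent), digit bound `B`
(≥ `K − 1`, ≥ 1) and `H · B^K < β`. -/
def coordFitsGrid (FT : List (ℤ × ℤ × ℤ × ℤ)) (rels : List LC) (ts : List CTerm) (β D₁ B K : ℕ) : Bool :=
  let S := coordShadow FT rels ts
  decide (1 ≤ D₁ ∧ S.1 ≤ D₁ ∧ 1 ≤ B ∧ K ≤ B + 1 ∧ coordKlen FT rels ts ≤ K ∧ S.2.2 * B ^ K < β)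

/-- **Coordinate-form module reduction, grid-packed.** If every relation evaluates to `0`, the terms are complementary
to `Zidx`, the shadows fit (`coordFitsGrid`), and for EVERY `k₀ < K` the two-variable packed `G` at `k = k₀` vanishes
(`K` separate kernel checks), then `fprod Zidx · Σ_X C_X·T[X] = 0`. -/
theorem coord_sum_mul_eq_zero_grid (T : ℕ → ℚ) (w x k : ℚ) (FT : List (ℤ × ℤ × ℤ × ℤ)) (rels : List LC)
    (Zidx : List ℕ) (ts : List CTerm) (β D₁ B K : ℕ) (h : ∀ R ∈ rels, lcEval T w x k 0 R = 0)
    (hok : ctermsOK Zidx ts = true) (hfit : coordFitsGrid FT rels ts β D₁ B K = true)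
    (hz : ∀ k₀ : ℕ, k₀ < K → zIsZero (coordGZ β ((β : ℤ) ^ D₁) k₀ FT
      (rels.map (packLC β ((β : ℤ) ^ D₁) k₀)) ts) = true) :
    fprod FT Zidx w x k * ctermSum T w x k FT ts = 0 := by
  simp only [coordFitsGrid, decide_eq_true_eq] at hfit
  obtain ⟨hD₁, hW, hB, hKB, hKlen, hH⟩ := hfit
  have hfits := lcFits_coordG FT rels ts
  have hklen := klen_coordG FT rels ts
  have hall : ∀ k₀ : ℕ, k₀ < K → ∀ c ∈ coordG FT rels ts, ∀ w' x' : ℚ, ev3 c w' x' k₀ = 0 := by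
    intro k₀ hk₀ c hc w' x'
    have hzk := hz k₀ hk₀
    rw [← packLC_coordG] at hzk
    have hzero := eq_zero_of_zIsZero _ hzk
    have hc' := hfits c hc
    refine ev3_kspec_eq_zero_of_packed c β D₁ (coordShadow FT rels ts).2.2 K B hD₁ hB
      (fun b hb r hr => ((hc'.1 b hb).2 r hr).trans hW) hc'.2 ((hklen c hc).trans hKlen) hH k₀ ?_ ?_ w' x'
    · simp only [Int.natAbs_natCast]; omega
    · exact hzero _ (List.mem_map.2 ⟨c, hc, rfl⟩)
  rw [← lcEval_coordG T w x k FT rels h Zidx ts hok]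
  exact lcEval_eq_zero_of_kgrid T w x k _ K (fun c hc => (hklen c hc).trans hKlen) hall

/-- **Coordinate-form module reduction, grid-packed** — with the non-vanishing of the common-denominator factors,
concluding `Σ_X C_X·T[X] = 0`. -/
theorem coord_sum_eq_zero_grid (T : ℕ → ℚ) (w x k : ℚ) (FT : List (ℤ × ℤ × ℤ × ℤ)) (rels : List LC) (Zidx : List ℕ)
    (ts : List CTerm) (β D₁ B K : ℕ) (h : ∀ R ∈ rels, lcEval T w x k 0 R = 0)
    (hZ : ∀ i ∈ Zidx, linVal (FT.getD i (0, 0, 0, 0)) w x k ≠ 0) (hok : ctermsOK Zidx ts = true)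
    (hfit : coordFitsGrid FT rels ts β D₁ B K = true)
    (hz : ∀ k₀ : ℕ, k₀ < K → zIsZero (coordGZ β ((β : ℤ) ^ D₁) k₀ FT
      (rels.map (packLC β ((β : ℤ) ^ D₁) k₀)) ts) = true) :
    ctermSum T w x k FT ts = 0 :=
  (mul_eq_zero.1 (coord_sum_mul_eq_zero_grid T w x k FT rels Zidx ts β D₁ B K h hok hfit hz)).resolve_left
    (fprod_ne_zero FT w x k Zidx hZ)

end Summit.KontsevichZagierPeriods.Zeta5Search.PolyReflect
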